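import Summits.BirchSwinnertonDyer.BirchSwinnertonDyer.Theorems.UniversalToricDescentStrictPlaceGrowthLocal
import Summits.BirchSwinnertonDyer.BirchSwinnertonDyer.Theorems.EisensteinPrimesAnticyclotomicLocalCdOne
import Summits.BirchSwinnertonDyer.BirchSwinnertonDyer.Theorems.QuadraticBranchSignedControlPlusEtaLowerInclusionTamagawaRoadLevel
import Literature.NumberTheory.EllipticCurves.IwasawaModuleFinitePadicIntProofs
import Literature.NumberTheory.EllipticCurves.KatoFineSelmerDualMuProofs
import HarnessLib

/-!
# Inputs of the growth-road assembly at the strict place: `p`-divisibility of `H¹(kerD, E[p^∞])` at a finitely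
# decomposed place, the uniform count `#Sel_𝔭^Σ(K_∞)[p^k] ≤ p^{ek+f}` from `Sel_𝔭^Σ[p]` finite, and the finiteness of
# the `γ^{p^n}`-fixed `p^k`-torsion of Castella's groups (crux ♭T≤ stmt-BirchSwinnertonDyer-23042, line
# `sigmacongruence`, stub TS1′ `stub_twinStrictSurj`, assembly (1e))

Route `UniversalToricDescent`, lead prover `bsd-wall-utd-p1` g16. THEOREMS ONLY (no definition, no named fact, no `sorry`);
`--supports stmt-BirchSwinnertonDyer-23042`. BSD is not proved by any of this.

* `exists_nsmul_eq_subgroupH1_kerD_of_apply_ne_one` — **`H¹(kerD κ v, E[p^∞])` is `p`-divisible** at every place `v`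
  not split completely in `K_∞` (`cd_p(ker κ ⊓ D_v) ≤ 1`, tree `exists_eq_nsmul_subgroupH1_inf_decomp`, transported along
  the tautological isomorphism `kerD κ v ≅ ker κ ⊓ D_v` exactly as in `…LocalH1DivisibleCurve`).
* `exists_natCard_pTorsion_pow_selmerAc_le` — if `Sel_𝔭^Σ(K_∞, E[p^∞])[p]` is finite (`Σ` finite) then for some `e, f`:
  `Sel_𝔭^Σ[p^k]` is finite with `# ≤ p^{ek+f}` for all `k` (`X_ac^Σ` is finitely generated over `Λ`, `X/pX` is finite, so `X`
  is finitely generated over `ℤ_p`, and `#S[p^k] ≤ p^{k·rank}·#tors`).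
* `finite_pTorsion_pow_conjH1_pow_fixed` — `{s ∈ Sel_{v₀}^Σ(K_∞, E[p^∞]) | p^k s = 0, conj_{γ^q} s = s}` is finite for all
  `k, q` (`X_ac^Σ` finitely generated, `…DualPairToolkit.finite_torsion_fixed_of_moduleFinite` at `(n, k)` with `p^n ∣`-free
  bookkeeping: `conj_{γ^q}`-fixed ⊆ `conj_{γ^{q p^n}}`-fixed is not needed — we take the set for `γ^{p^n}` directly).

References: [GreenbergLNM1716] §1 p. 60, §4 Lemma 4.5; [GreenbergVatsal2000] §2 Prop. (2.1); [Washington1997] §13.2.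
-/

set_option autoImplicit false
-- the Theorems namespace of this sub repeats the summit name by design (D-0017 nested layout)
set_option linter.dupNamespace false

noncomputable section

open scoped Classical

namespace Summit.BirchSwinnertonDyer.BirchSwinnertonDyer.Theorems.UniversalToricDescentStrictPlaceGrowth

open Function Field NumberField IsDedekindDomain WeierstrassCurve
open Literature.NumberTheory.GaloisRepresentations Literature.NumberTheory.EllipticCurves
  Literature.NumberTheory.EllipticCurves.GreenbergSelmer Literature.NumberTheory.EllipticCurves.IwasawaDual
  Summit.BirchSwinnertonDyer.Rank1Residual Summit.BirchSwinnertonDyer.Rank1Residual.X11b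
  Summit.BirchSwinnertonDyer.Rank1Residual.X11b.Coinv Summit.BirchSwinnertonDyer.Rank1Residual.X11b.AcSelmer
  Summit.BirchSwinnertonDyer.BirchSwinnertonDyer.Theorems.UniversalToricDescentTorsionFreeByCount
  Summit.BirchSwinnertonDyer.BirchSwinnertonDyer.Theorems.AnticyclotomicLocalCdOne

variable {K : Type} [Field K] [NumberField K] (W : WeierstrassCurve K) [W.IsElliptic] (p : ℕ)
  [Fact p.Prime] (κ : ZpExtension K p)

/-! ### §1 `H¹(kerD κ v, E[p^∞])` is `p`-divisible at a finitely decomposed place -/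

/-- **`H¹(kerD κ v, E[p^∞])` is `p`-divisible** whenever some `τ ∈ D_v` has `κ τ ≠ 1` (any place `v`, also `v ∣ p`):
`cd_p(ker κ ⊓ D_v) ≤ 1` (tree `exists_eq_nsmul_subgroupH1_inf_decomp`) transported along `kerD κ v ≅ ker κ ⊓ D_v`.
[cite: GreenbergLNM1716, §4 Lemma 4.5 and the paragraph after it] [cite: SerreGaloisCohomology1997, II §3.3 Prop. 9] -/
theorem exists_nsmul_eq_subgroupH1_kerD_of_apply_ne_one {v : HeightOneSpectrum (𝓞 K)}
    (hne : ∃ τ ∈ decomp v, κ τ ≠ 1)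
    (f : subgroupH1 (kerD κ v) (W.geomPrimaryTorsion p)) :
    ∃ f' : subgroupH1 (kerD κ v) (W.geomPrimaryTorsion p), p • f' = f := by
  let A : Type := W.geomPrimaryTorsion p
  let D : Subgroup (absoluteGaloisGroup K) := κ.kerSubgroup ⊓ decomp v
  let θ₃ : kerD κ v →ₜ* D :=
    { toFun := fun x ↦ ⟨((x : decomp (K := K) v) : absoluteGaloisGroup K),
        Subgroup.mem_inf.mpr ⟨(mem_kerD_iff κ v _).1 x.2, (x : decomp (K := K) v).2⟩⟩
      map_one' := rfl
      map_mul' := fun _ _ ↦ rfl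
      continuous_toFun := (continuous_subtype_val.comp continuous_subtype_val).subtype_mk _ }
  let θ₄ : D →ₜ* kerD κ v :=
    { toFun := fun x ↦ ⟨⟨(x : absoluteGaloisGroup K), (Subgroup.mem_inf.mp x.2).2⟩,
        (mem_kerD_iff κ v _).2 (Subgroup.mem_inf.mp x.2).1⟩
      map_one' := rfl
      map_mul' := fun _ _ ↦ rfl
      continuous_toFun := (continuous_subtype_val.subtype_mk _).subtype_mk _ }
  have hθ₄₃ : θ₄.comp θ₃ = ContinuousMonoidHom.id (kerD κ v) := ContinuousMonoidHom.ext fun _ ↦ rfl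
  let r₃ := resH1Hom θ₃ (AddMonoidHom.id A) fun x m ↦ (rfl : θ₃ x • m = x • m)
  let r₄ := resH1Hom θ₄ (AddMonoidHom.id A) fun x m ↦ (rfl : θ₄ x • m = x • m)
  have hcomp : r₃.comp r₄ = AddMonoidHom.id _ := by
    rw [resH1Hom_comp, resH1Hom_congr hθ₄₃ (AddMonoidHom.comp_id _) _ (fun _ _ ↦ rfl), resH1Hom_id]
  obtain ⟨t, ht⟩ := exists_eq_nsmul_subgroupH1_inf_decomp κ v hne
    (fun m ↦ continuous_smul_geomPrimaryTorsion W p m)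
    (fun m ↦ exists_nsmul_eq_geomPrimaryTorsion W p (zsmul_geomPoints_surjective_holds W) m) (r₄ f)
  refine ⟨r₃ t, ?_⟩
  rw [← map_nsmul, ← ht]
  exact DFunLike.congr_fun hcomp f

/-- `κ d ≠ 1` for `d ∈ D_𝔭` with `κ d = p^c` (so `𝔭` does not split completely in `K_∞`). [folklore] -/
theorem exists_mem_decomp_apply_ne_one_of_toAdd_eq {𝔭 : HeightOneSpectrum (𝓞 K)} {c : ℕ} (d₁ : decomp (K := K) 𝔭)
    (hd₁ : (κ (d₁ : absoluteGaloisGroup K)).toAdd = (p : ℤ_[p]) ^ c) :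
    ∃ τ ∈ decomp 𝔭, κ τ ≠ 1 := by
  refine ⟨d₁, d₁.2, fun h ↦ ?_⟩
  have : (κ (d₁ : absoluteGaloisGroup K)).toAdd = 0 := by rw [h, toAdd_one]
  rw [hd₁] at this
  exact pow_ne_zero c (Nat.cast_ne_zero.mpr (Fact.out : p.Prime).ne_zero) this

/-! ### §2 `#Sel_𝔭^Σ(K_∞, E[p^∞])[p^k] ≤ p^{ek+f}` from `Sel_𝔭^Σ[p]` finite -/

/-- **If `Sel_𝔭^Σ(K_∞, E[p^∞])[p]` is finite (`Σ` finite), then `Sel_𝔭^Σ[p^k]` is finite with `# ≤ p^{ek+f}` for all `k`**,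
for some `e, f`: the dual `X = X_ac^Σ` is finitely generated over `Λ` (`XAc.module_finite`), `X/pX` is finite
(`IwasawaDual.finite_quotient_pSmul_of_finite_pTorsion`), so `X` is finitely generated over `ℤ_p`
(`moduleFinite_padicInt_of_finite_quotient_augIdealP`) and `#S[p^k] ≤ p^{k·rank} · #X_tors`
(`TamagawaRoad.natCard_torsionBy_pow_le_pow_finrank_mul_natCard_torsion`). [cite: GreenbergLNM1716, §1 p. 60] -/
theorem exists_natCard_pTorsion_pow_selmerAc_le {γ : absoluteGaloisGroup K} (hγ : κ.IsTopGenerator γ)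
    (𝔭 : HeightOneSpectrum (𝓞 K)) {S : Set (HeightOneSpectrum (𝓞 K))} (hS : S.Finite)
    (hfin : Set.Finite {s : selmerAc W p κ 𝔭 S | p • s = 0}) :
    ∃ e f : ℕ, ∀ k : ℕ, Finite {s : selmerAc W p κ 𝔭 S // p ^ k • s = 0} ∧
      Nat.card {s : selmerAc W p κ 𝔭 S // p ^ k • s = 0} ≤ p ^ (e * k + f) := by
  haveI : Fact (κ.IsTopGenerator γ) := ⟨hγ⟩
  have hd := XAc.isDualPair W p κ 𝔭 S γ
  haveI : Module.Finite (IwasawaAlgebra p) (XAc W p κ 𝔭 S γ) := XAc.module_finite κ 𝔭 S γ hS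
  have hXp : Finite (XAc W p κ 𝔭 S γ ⧸
      (IwasawaAlgebra.augIdealP p • (⊤ : Submodule (IwasawaAlgebra p) (XAc W p κ 𝔭 S γ)))) :=
    IwasawaDual.finite_quotient_pSmul_of_finite_pTorsion hd.bijective hd.C_smul hd.locNil.torsion hfin
  have hfg : Module.Finite ℤ_[p] (RestrictScalars ℤ_[p] (IwasawaAlgebra p) (XAc W p κ 𝔭 S γ)) :=
    IwasawaModuleFinitePadicInt.moduleFinite_padicInt_of_finite_quotient_augIdealP p (XAc W p κ 𝔭 S γ) hXp
  let Ψ : RestrictScalars ℤ_[p] (IwasawaAlgebra p) (XAc W p κ 𝔭 S γ) ≃+ CharacterModule (selmerAc W p κ 𝔭 S) :=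
    (RestrictScalars.addEquiv ℤ_[p] (IwasawaAlgebra p) (XAc W p κ 𝔭 S γ)).trans
      (AddEquiv.ofBijective (AddMonoidHom.id (XAc W p κ 𝔭 S γ)) hd.bijective)
  refine ⟨@Module.finrank ℤ_[p] (RestrictScalars ℤ_[p] (IwasawaAlgebra p) (XAc W p κ 𝔭 S γ)) _ _
      (RestrictScalars.module ℤ_[p] (IwasawaAlgebra p) (XAc W p κ 𝔭 S γ)),
    Nat.card (AddCommGroup.torsion (RestrictScalars ℤ_[p] (IwasawaAlgebra p) (XAc W p κ 𝔭 S γ))), fun k ↦ ?_⟩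
  -- (instances passed explicitly: `RestrictScalars.addCommGroup.toAddCommMonoid` vs `RestrictScalars.addCommMonoid`)
  obtain ⟨hfin', hle⟩ := @TamagawaRoad.natCard_torsionBy_pow_le_pow_finrank_mul_natCard_torsion p _ k
    (RestrictScalars ℤ_[p] (IwasawaAlgebra p) (XAc W p κ 𝔭 S γ)) _
    (RestrictScalars.module ℤ_[p] (IwasawaAlgebra p) (XAc W p κ 𝔭 S γ)) hfg _ _ Ψ
  have e : Nat.card (AddSubgroup.torsionBy (selmerAc W p κ 𝔭 S) ((p ^ k : ℕ) : ℤ)) =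
      Nat.card {s : selmerAc W p κ 𝔭 S // p ^ k • s = 0} :=
    Nat.card_congr (Equiv.subtypeEquivRight fun a ↦ AddSubgroup.torsionBy.nsmul_iff)
  haveI := hfin'
  refine ⟨Finite.of_equiv _ (Equiv.subtypeEquivRight fun a ↦ AddSubgroup.torsionBy.nsmul_iff), ?_⟩
  rw [← e]
  refine hle.trans ?_
  rw [pow_add, mul_comm k]
  exact Nat.mul_le_mul_left _ (Nat.lt_pow_self (Fact.out : p.Prime).one_lt).le

/-! ### §3 The `γ^{q}`-fixed `p^k`-torsion of `Sel_{v₀}^Σ(K_∞, E[p^∞])` is finite -/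

/-- **`{s ∈ Sel_{𝔭}^Σ(K_∞, E[p^∞]) | p^k s = 0, conj_γ^{p^n} s = s}` is finite** for every `𝔭`, finite `Σ` and
topological generator `γ`: `X_ac^Σ` is finitely generated over `Λ` (`XAc.module_finite`) and these are the character
groups of `X/(p^k, ω_n)X` (`finite_torsion_fixed_of_moduleFinite`). [cite: GreenbergLNM1716, §1 p. 60] -/
theorem finite_pTorsion_pow_conjH1_pow_fixed {γ : absoluteGaloisGroup K} (hγ : κ.IsTopGenerator γ)
    (𝔭 : HeightOneSpectrum (𝓞 K)) {S : Set (HeightOneSpectrum (𝓞 K))} (hS : S.Finite) (n k : ℕ) :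
    Set.Finite {s : selmerAc W p κ 𝔭 S |
      p ^ k • s = 0 ∧ W.conjH1 p κ.kerSubgroup (γ ^ p ^ n) (s : W.subgroupH1 p κ.kerSubgroup) = s} := by
  haveI : Fact (κ.IsTopGenerator γ) := ⟨hγ⟩
  have hd := XAc.isDualPair W p κ 𝔭 S γ
  haveI : Module.Finite (IwasawaAlgebra p) (XAc W p κ 𝔭 S γ) := XAc.module_finite κ 𝔭 S γ hS
  have hfin := finite_torsion_fixed_of_moduleFinite p hd n k
  refine (Set.finite_coe_iff.mp hfin).subset fun s hs ↦ ?_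
  obtain ⟨hs1, hs2⟩ := hs
  rw [SetLike.mem_coe, AddSubgroup.mem_inf, AddMonoidHom.mem_ker, AddMonoidHom.mem_ker,
    DistribSMul.toAddMonoidHom_apply, add_sub_cancel]
  refine ⟨hs1, ?_⟩
  change ((conjSelmerAc W p κ 𝔭 S γ) ^ p ^ n) s - s = 0
  rw [sub_eq_zero]
  exact Subtype.ext (by rw [coe_conjSelmerAc_pow_apply]; exact hs2)

end Summit.BirchSwinnertonDyer.BirchSwinnertonDyer.Theorems.UniversalToricDescentStrictPlaceGrowth

end
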